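import Literature.IUT.HodgeTheaters.PMBaseSyncIndependenceProofs
import HarnessLib

/-!
# [IUTchI] Prop 6.5 (i), second sentence (`DThetaEllBridge.XiGroupCompat`) is a SCHEMA over the frozen base interface `PMBaseKit` —
# universal-closure certificate, binder-free (proof-only)

S. Mochizuki, *Inter-universal Teichmüller theory I: construction of Hodge theaters*, kurims manuscript (May 2020), Prop 6.5 (i)
p. 164 («the bijection `†ξ^{Θell}_{v_t,w_t}` … is compatible with the respective `𝔽_l^±`-group structures»), Ex 6.3 (i) pp. 160–161
(«we obtain a natural bijection `LabCusp^±(†𝒟_v) ⥲ 𝔽_l^±` … well-defined up to multiplication by `±1`») [claim: Mochizuki2012,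
status: disputed] (D-0012 claim key; series status DISPUTED — kernel theorems about abc-iut-L5-t4's INTERFACE `PMBaseKit` and
abc-iut-w4-d073's kits over it; nothing of the series is asserted, no side is taken on [IUTchIII] Cor. 3.12).

abc-iut cell, FACT-LIST row **F-2019** (`PMBaseKit.DThetaEllBridge.XiGroupCompat`, `PMBaseBridgeProps.lean`), layer L5, lane
«KL5-CLOSURE-CERTS» (abc-iut-w6-d089 g5 decided 9 of the 13 LABEL-OPEN HYPOTHESIS-CLASS [IUTchI] rows and left F-2019 «not taken»;
`plan/LF-KERNEL-STATUS.tsv` 04:10Z: F-2019 mechanical class «?», «conditional refuters (¬ under Prop hypotheses — not a closure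
refutation by itself)»); seat abc-iut-L5-t13 gen 8.  PROOF-ONLY, nothing re-typed, no `def`.

Everything substantive is in tree: the conditional closer `DThetaEllBridge.xiGroupCompat_of_sync (hsync : Ex63.PhiEllSync K)`
(abc-iut-L5-t4, `PMBaseDischarge`), the exact side condition `forall_xiGroupCompat_iff_relSync` and the assembled
`DThetaEllBridge.xiGroupCompat_exact_side_condition_verdict` (`PMBaseXiGroupCompatExactSideCondition`), the consistency witness
`Ex63.phiEllSync_toyKit` and the CONDITIONAL refuter `DThetaEllBridge.exists_kit_not_xiGroupCompat (l) [Fact l.Prime] (hl : l ≠ 2)`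
(abc-iut-w4-d073, `PMBaseSyncIndependenceProofs`, on abc-iut-L5-t13's translation kit of `Ex63.exists_kit_not_equivariant`).  What the
closure lane lacked for its mechanical class is the BINDER-FREE universal-closure decision — one instantiation away: at the prime
`l = 3 ≠ 2` (Mathlib `Nat.fact_prime_three`) the conditional refuter fires with no hypothesis left (the pattern of
`exists_fKitCore_not_phiEllSync_five`, `KitCorePhiEllSyncIndependence`, which closed F-2029 `Ex63.PhiEllSync` the same way).  In the
grammar of `PuncturedEllipticCoveringsRmk121ClosureCertificate` (`exists_not_…` / `not_forall_…` / `…_schema`):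
* `DThetaEllBridge.exists_not_xiGroupCompat`, `DThetaEllBridge.not_forall_xiGroupCompat` — **F-2019's universal closure over the
  interface is FALSE**, no binder (two-valuation toy kit at `l = 3`, `φ^{Θell}` the identity at one valuation and the translation
  `z ↦ z + 1` at the other: `†ξ^{Θell} = (z ↦ z − 1)` is not a sign);
* `DThetaEllBridge.exists_xiGroupCompat`, `DThetaEllBridge.xiGroupCompat_schema` — and CONSISTENT, no binder (the model bridge
  `Ex63.bridge` over `toyKit 3`, through `phiEllSync_toyKit` + `xiGroupCompat_of_sync`): **F-2019 is a SCHEMA**; its content is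
  `xiGroupCompat_of_sync` under Ex 6.3 (i)'s synchronisation law (α), discharged BY NAME at every genuine §6 kit
  (`xiGroupCompat_baseKit*`, `xiGroupCompat_baseKitThetaNF*`).
HONEST FRAMING: a refuted universal closure is a statement about OUR typing of the interface (which records the pulled-back chart
only up to the `𝔽_l^{⋊±}`-orbit, separately at each `v` — audit R7-L5t4-F1), not about Prop 6.5 (i) in print, where the
`φ^{Θell}_{•,v}` are the natural composites `X→_v → X_v → X_K` and (α) holds; refuted-as-typed ≠ refuted-in-print; typed ≠ proved;
nothing here bears on [IUTchIII] Cor. 3.12 or asserts anything about abc.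
-/

namespace Literature.IUT.HodgeTheaters

namespace PMBaseKit

/-! ## F-2019 `DThetaEllBridge.XiGroupCompat`: consistent ∧ independent, binder-free -/

/-- **F-2019, refuting instance with no binder**: there are a prime `l` (namely `3`), a kit `K : PMBaseKit l` and a `𝒟-Θ^{ell}`-bridge
`B` over it for which `†ξ^{Θell}_{v_t,w_t}` is NOT compatible with the `𝔽_l^±`-group structures (abc-iut-w4-d073's
`exists_kit_not_xiGroupCompat` at `l = 3`: two valuations, `φ^{Θell}` the identity at one and the translation `z ↦ z + 1` at the other).
([IUTchI] Prop 6.5 (i) p.164) [claim: Mochizuki2012, status: disputed] -/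
theorem DThetaEllBridge.exists_not_xiGroupCompat :
    ∃ (l : ℕ) (_ : Fact l.Prime) (K : PMBaseKit.{0} l) (B : K.DThetaEllBridge), ¬ B.XiGroupCompat := by
  haveI : Fact (Nat.Prime 3) := Nat.fact_prime_three
  obtain ⟨K, B, hB⟩ := DThetaEllBridge.exists_kit_not_xiGroupCompat 3 (by decide)
  exact ⟨3, inferInstance, K, B, hB⟩

/-- **F-2019: the universal closure of `DThetaEllBridge.XiGroupCompat` over the interface is FALSE** — Prop 6.5 (i), second sentence,
AS TYPED over the frozen `PMBaseKit`, is not a theorem of the interface (audit R7-L5t4-F1 made kernel-checked and binder-free).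
([IUTchI] Prop 6.5 (i) p.164) [claim: Mochizuki2012, status: disputed] -/
theorem DThetaEllBridge.not_forall_xiGroupCompat :
    ¬ ∀ (l : ℕ) (_ : Fact l.Prime) (K : PMBaseKit.{0} l) (B : K.DThetaEllBridge), B.XiGroupCompat := fun h => by
  obtain ⟨l, hl, K, B, hB⟩ := DThetaEllBridge.exists_not_xiGroupCompat
  exact hB (h l hl K B)

/-- **F-2019, satisfying instance with no binder**: the model `𝒟-Θ^{ell}`-bridge `Ex63.bridge` of Example 6.3 (i) over the
consistency model `toyKit 3` IS group-compatible (`xiGroupCompat_of_sync` ∘ `phiEllSync_toyKit`).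
([IUTchI] Prop 6.5 (i) p.164) [claim: Mochizuki2012, status: disputed] -/
theorem DThetaEllBridge.exists_xiGroupCompat :
    ∃ (l : ℕ) (_ : Fact l.Prime) (K : PMBaseKit.{0} l) (B : K.DThetaEllBridge), B.XiGroupCompat := by
  haveI : Fact (Nat.Prime 3) := Nat.fact_prime_three
  haveI : NeZero (3 : ℕ) := ⟨by decide⟩
  exact ⟨3, inferInstance, toyKit 3 (by decide), Ex63.bridge (toyKit 3 (by decide)),
    DThetaEllBridge.xiGroupCompat_of_sync (Ex63.phiEllSync_toyKit 3 (by decide)) _⟩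

/-- **F-2019 is a SCHEMA** (consistent ∧ independent over the interface, hypothesis-free); its content is the conditional closer
`xiGroupCompat_of_sync` under Ex 6.3 (i)'s synchronisation law, discharged by name at every genuine §6 kit.
([IUTchI] Prop 6.5 (i) p.164) [claim: Mochizuki2012, status: disputed] -/
theorem DThetaEllBridge.xiGroupCompat_schema :
    (∃ (l : ℕ) (_ : Fact l.Prime) (K : PMBaseKit.{0} l) (B : K.DThetaEllBridge), B.XiGroupCompat) ∧
      ∃ (l : ℕ) (_ : Fact l.Prime) (K : PMBaseKit.{0} l) (B : K.DThetaEllBridge), ¬ B.XiGroupCompat :=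
  ⟨DThetaEllBridge.exists_xiGroupCompat, DThetaEllBridge.exists_not_xiGroupCompat⟩

end PMBaseKit

end Literature.IUT.HodgeTheaters
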